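import Mathlib
import HarnessLib
import HarnessLib.Audit
import Summits.FinalStateConjecture.Statement
import Literature.Geometry.Lorentzian.CauchyDevelopment
import Literature.Geometry.Lorentzian.FinalState
import Literature.Geometry.Lorentzian.KerrConvergence
import Literature.Geometry.Lorentzian.KerrSchild
import Literature.Geometry.Lorentzian.Hypersurface
import Literature.Geometry.Lorentzian.AsymptoticFlatness
import HarnessLib.Audit.Status.Attr

/-!
Route: LapseTrumpetKID

DORMANT since 2026-08-23T10:32:59Z (reconciler: no traction for 6.1 d (last activity statement-grounded at 2026-08-17T08:08:36Z); parked, not closed — `ledger route dormant route-FinalStateConjecture-LapseTrumpetKID --off` to reactivate) — unstaffed, not closed; items shared with open routes are served there. `ledger route dormant <id> --off` reactivates.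

# Route LapseTrumpetKID — where time stops — in maximal gauge the generic final state is a vacuum
KID with one flat end and N trapped Kerr-trumpet ends

It suffices to show X = X1 ∧ X2 ∧ X3 (card collapse-of-the-lapse-trumpet-kid, crux-first). X1 =
MAXIMAL CENSORSHIP (the ONLY generic
clause — maximal-gauge weak cosmic censorship + singularity avoidance + the third law in slice
form): for TAME-Christodoulou-generic admissible
data (the audited Statement's `IsTameChristodoulouGeneric … 1`, re-type T2 of 2026-08-16: the
witness family through an exceptional datum is
tame on ONE fixed AF end and immersed at 0) an MGHD exists and every MGHD has complete 𝓘⁺ and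
carries a NORMALISED MAXIMAL CAUCHY FOLIATION F : ℝ × X → M (smooth; every leaf a
smooth embedding of X onto a Cauchy hypersurface whose induced data form a complete, maximal (tr k =
0), asymptotically flat one-ended
InitialDataSet; lapse N = −g(∂ₜF, ν) > 0 with N → 1 at spatial infinity for t ≥ 0) whose LAPSE WELLS
ARE TRAPPED (some ε > 0, t₀: for
t ≥ t₀ a point with N < ε cannot causally reach the region N > 1 − ε of any later leaf — "where time
stops is inside a black hole").
X2 = SETTLING IN MAXIMAL GAUGE (deterministic, every admissible datum): an MGHD with complete 𝓘⁺
carrying such a foliation settles, in the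
typed sense, to finitely many Kerr exteriors (|aᵢ| ≤ Mᵢ) plus radiation on the self-determined
exterior O = exteriorOf 𝒟 d.charted, with every
future-complete normalised null ray from the data staying in closure O (`RaysStayInClosure`),
honest-radii exhaustive charts
(`HasExhaustiveCharts`) and future-oriented chart time (`IsFutureOriented`) — the audited
Statement's per-development clause verbatim,
minus sub-extremality — to be earned at
layer 2 as TrumpetLimits (leaves converge on growing leaf-adapted near zones to x⁰-stationary vacuum
TRUMPET MODELS = Killing developments
of trumpet KIDs, wells separating on straight sublinear tracks, certified zones exhausting J⁺(ιX) ∩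
I⁻(far zone)) → TrumpetKIDRigidity
(typed now: a stationary vacuum trumpet model embeds time-equivariantly into sub-extremal
Kerr–Schild Kerr) → SliceDictionary (typed
now). X3 = TRAPPED WELLS ARE SUB-EXTREMAL (deterministic slice-level third law): with trapped wells
every exhaustive typed decomposition
has |aᵢ| < Mᵢ (an extremal remnant makes time stop OUTSIDE its horizon). Monotonicity of tame
Christodoulou genericity in the property then
gives the Statement from X1, X2, X3 by pure logic (theorem `closes`, crux-only, sorry-free;
route-repair 2026-08-16 after the Statement
re-type T2).
Lean: `MaximalCensorship ∧ SettlingInMaximalGauge ∧ TrappedWellsSubextremal`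

## Assembly
Pure logic (theorem `closes : MaximalCensorship → SettlingInMaximalGauge → TrappedWellsSubextremal →
TrumpetKIDRigidity →
FinalStateConjecture`, crux-only, sorry-free, certified natively; conclusion
`_root_.FinalStateConjecture` by name):
`IsTameChristodoulouGeneric 𝓓 P 1 = HasTameCodimAtLeastIn 𝓓 {d ∈ 𝓓 | ¬P d} 1` is MONOTONE in P (a
pointwise implication Q → P on 𝓓
shrinks the exceptional set; the tame, immersed, injective one-parameter admissible family on its
fixed end witnessing codimension for Q
witnesses it for P) — proved inline as `mono` and applied to MaximalCensorship X. Pointwise: keep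
MGHD-existence and complete 𝓘⁺; feed
(F, ν) with clauses (ii)–(iii) to SettlingInMaximalGauge to get O, d, O = exteriorOf,
RaysStayInClosure, HasExhaustiveCharts,
IsFutureOriented; TrappedWellsSubextremal (fed O = exteriorOf and HasExhaustiveCharts) gives |aᵢ| <
Mᵢ. TrumpetKIDRigidity rides as the
fourth crux hypothesis (the identification step of SettlingInMaximalGauge's intended proof; unused
by the term). No named fact is used.

Rationale: WHY THIS LINE. Maximal slicing (tr k = 0, ΔN = |k|²N, N → 1 at i⁰) is the one canonical,
teleology-free gauge in which black holes announce themselves on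
each Cauchy leaf: the lapse collapses where gravity is strong, the leaves avoid the singular
interior and pile up on a limit maximal
cylinder inside each hole (Schwarzschild: r = 3M/2, N ~ e^{−t/τ}, doi:10.1103/PhysRevD.7.2814,
doi:10.1103/PhysRevD.57.4728), and
numerical relativity universally sees punctures freeze into stationary trumpets, one per hole
(doi:10.1103/PhysRevD.78.064020,
doi:10.1103/PhysRevLett.113.261101; boosted: doi:10.1103/PhysRevD.98.044014). Imported structure:
every leaf is a complete one-ended AF
Riemannian 3-manifold with R = |k|² ≥ 0 (positive mass, Riemannian Penrose, minimal-surface and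
Harnack tools slice by slice); a limit
of the maximal-gauge flow with ∂ₜ(h,k,N,β) → 0 is a Killing initial data set (arXiv:gr-qc/9604040),
so stationarity of ω-limits is
definitional and the difficulty sits in convergence and identification (TrumpetKIDRigidity); and the
trapped dying-lapse end of the limit
trumpet is a slice-level signature of a SUB-extremal horizon (an extremal throat has small lapse in
the exterior), so the third law rides
as the short deterministic crux TrappedWellsSubextremal. The logical shape is forced: Christodoulou
genericity is monotone in the property
but not closed under conjunction (card genericity-is-not-closed-under-and), so WCC, singularity
avoidance and trapping of wells sit in ONE
generic crux and everything else is stated for all admissible data. Areas: elliptic gauge theory of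
maximal foliations
(doi:10.1007/bf01209300, ChristodoulouKlainerman1993), Riemannian geometry of R ≥ 0 ends,
KID/stationary rigidity (doi:10.1007/BF00770326,
ChruscielCosta2008, arXiv:0904.0982); no probabilistic or spectral reformulation. No prior route
exists for this summit; negatives index
empty. Gate note: the 4000-char signature cap keeps the layer-2 child TrumpetLimits informal until
the requested definitions land; its
two siblings (TrumpetKIDRigidity, SliceDictionary) are typed now.

RANKED CRUXES. #2 MaximalCensorship (crux) — GENERIC CLAUSE (card K1 ⊕ the WCC conjunct ⊕ trapping
of wells; the only item stated for generic data — TAME-Christodoulou-generic,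
`IsTameChristodoulouGeneric … 1`, since the route-repair of 2026-08-16 that followed the Statement
re-type T2): for tame-generic admissible D an MGHD exists and every MGHD 𝒟 (i) has complete 𝓘⁺
(`HasCompleteNullInfinity`); (ii) carries a normalised maximal Cauchy foliation — F : ℝ × X →
𝒟.carrier smooth with future unit normals ν; every x ↦ F(t,x) a smooth embedding onto a Cauchy
hypersurface; the induced (h,k) agree with an InitialDataSet on X that is maximal (tr k = 0),
complete, asymptotically flat of order 1 with a sole end; lapse N = −g(∂ₜF, ν) > 0 everywhere and
N(t,·) → 1 cocompactly for t ≥ 0; (iii) WELLS TRAPPED: ∃ ε > 0, t₀ such that t ≥ t₀, N(t,x) < ε, t'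
≥ t, N(t',x') > 1 − ε ⇒ F(t',x') ∉ J⁺(F(t,x)). [difficulty: open-problem] (why it might fail:
Contains weak cosmic censorship; complete maximal Cauchy leaves for all late times = singularity
avoidance, proved only for crushing singularities / a = 0 (Eardley–Smarr, Beig–Ó Murchadha) and open
for exact Kerr a ≠ 0 (leaves must stay off the Cauchy horizon); the gauge is global in space;
SIGNATURE DEFECT (retriage 2026-08-15, open for tenure): on X = Σ∖{p} with Σ closed non-PSC (T³)
admissible data exist (IMP gr-qc/0206034 Thm 1) but no maximal AF Cauchy leaf ≅ X does (R = |k|² ≥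
0), so (ii) fails on all of 𝓓(X) ≠ ∅ there — the ∀ X clause needs a topology-robust leaf class.)
[arXiv:gr-qc/0206034, doi:10.1007/bf01209300, doi:10.1103/PhysRevD.19.2239,
doi:10.1103/PhysRevD.57.4728, arXiv:gr-qc/9608045, Christodoulou1999, arXiv:1710.01722,
arXiv:2211.15742]
#3 SettlingInMaximalGauge (crux) — SETTLING ALONG THE MAXIMAL FOLIATION (card K2 ⊕ K3 ⊕ K4 ⊕ P3 as
ONE layer-1 node; deterministic, ALL admissible D): if an MGHD 𝒟 of an admissible datum has complete
𝓘⁺ and carries a normalised maximal Cauchy foliation (F, ν) with trapped wells (clauses (ii)–(iii)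
of MaximalCensorship verbatim), then there are O and a typed `FinalStateDecomposition 𝒟.toSpacetime
O 2` (finitely many boosted Kerr exteriors with |aᵢ| ≤ Mᵢ, a flat radiation chart, separation,
sublinear excision) with O = exteriorOf 𝒟 d.charted, `RaysStayInClosure 𝒟 O` (every future-complete
normalised null ray from the data stays in closure O), `HasExhaustiveCharts d` (honest radii Rᵢ ≥
max(r₊,0)+1, Rᵢ → ∞) and `IsFutureOriented d` (orthochronous motions, chart time = g-future) — the
audited Statement's per-development clause minus sub-extremality (route-repair 2026-08-16 after the
Statement re-type T2; before it the conclusion was the pair O = exteriorOf, HasExhaustiveCharts).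
Intended proof = its layer-2 split: TrumpetLimits (pointed C² limits of the leaves at the separating
wells exist and are x⁰-stationary vacuum trumpet models, far limit flat, census finite, certified
zones exhaustive, late charted leaves see every future-complete null ray from the data in the
closure of their past, leaf-adapted charts future-oriented) → TrumpetKIDRigidity → SliceDictionary
(conclusion to be upgraded to the T2 clause at the split). [deps: MaximalCensorship] [difficulty:
open-problem] (why it might fail: Typed, it is clause (ii) of the conjecture made deterministic
given the gauge: the large-data decay problem (frozen wells carry no red-shift,
trapping/superradiant losses are gauge-blind, no late well may nucleate) plus rigidity; false if
some admissible datum with trapped wells radiates forever.) [ChristodoulouKlainerman1993,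
arXiv:0811.0354, doi:10.1103/PhysRevD.57.4728, doi:10.1103/PhysRevD.78.064020, arXiv:0811.4721,
arXiv:1004.2938, arXiv:2104.08222]
#4 TrappedWellsSubextremal (crux) — THE THIRD LAW IN SLICE FORM (deterministic): for an admissible
D, an MGHD with complete 𝓘⁺ and a normalised maximal Cauchy foliation with trapped wells (clauses
(ii)–(iii) verbatim), EVERY typed exhaustive decomposition (O = exteriorOf 𝒟 d.charted,
HasExhaustiveCharts d) has sub-extremal holes, |aᵢ| < Mᵢ for all i: an extremal remnant would carry
a lapse well down its throat OUTSIDE the horizon, i.e. an untrapped well. Supplies the Statement's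
`Kerr.IsSubextremal` clause without a separate generic crux. [deps: MaximalCensorship] [difficulty:
L] (why it might fail: Needs: a final hole with |a| = M forces arbitrarily small lapse outside the
horizon on late maximal leaves (the extremal throat as a lapse well) — unproved even for maximal
slicings of exact extremal Kerr; near-horizon near-extremal transients must respect the ε/t₀
thresholds.) [arXiv:2211.15742, arXiv:1710.01722, doi:10.1103/PhysRevD.57.4728,
Literature.Barriers.FinalStateConjecture.AretakisInstability]
#5 TrumpetKIDRigidity (crux) — TRUMPET-KID RIGIDITY (card K3, spacetime form; the identification
child of SettlingInMaximalGauge, typed now): an x⁰-stationary vacuum trumpet model — U ⊆ ℝ⁴ open and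
∂₀-invariant, γ a C^∞ Lorentzian metric invariant under x⁰-translation, Ricci-flat, γ(∂₀,∂₀) bounded
above; the slab V = U ∩ {x⁰ = 0} ≅ ℝ³∖{0} with unit normal carrying induced data that form a
complete maximal InitialDataSet, asymptotically flat of order 1 at an end e where the model lapse
−γ(∂₀,ν) → 1; lapse > 0, → 0 off e outside compacts; small-lapse points unable to causally reach the
tube over the far part of e (any time orientation making ν future) — embeds into SUB-EXTREMAL Kerr:
∃ (M,a), |a| < M, c > 0, a smooth injective χ : U → ℝ⁴ with χ(U) ⊆ {r > 0}, χ(U) ⊇ {r > r₁} for some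
r₁ < r₊, χ^*(Kerr–Schild g_{M,a}) = γ and χ(x + s e₀) = χ(x) + c s e₀. (Killing development of a
trumpet KID = a T-invariant region {r > r_c(θ)} of Kerr; the trapped dying-lapse end excludes
extremal throats, white-hole trumpets and solitons; the AF end excludes NUT charge.) [difficulty:
open-problem] (why it might fail: Contains smooth (non-analytic) stationary vacuum black-hole
uniqueness for holes admitting trumpet maximal slicings (Ionescu–Klainerman barrier): unconditional
only if static (Bunting–Masood), axisymmetric, or near Kerr (AIK); a non-Kerr stationary vacuum hole
with a trumpet slice refutes it.) [doi:10.1007/BF00770326, arXiv:gr-qc/9604040, ChruscielCosta2008,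
arXiv:0904.0982, arXiv:1108.3575, doi:10.1103/PhysRevLett.113.261101,
Literature.Barriers.FinalStateConjecture.IonescuKlainermanNonExtension]
#9 SliceDictionary (support) — DICTIONARY TO THE TYPED STATEMENT (card P3; the glue child of
SettlingInMaximalGauge, typed now): for an admissible D, an MGHD 𝒟 and a map F : ℝ × X → 𝒟.carrier,
if there are n, ∂₀-invariant models (Uᵢ ⊆ ℝ⁴, γᵢ) each Kerr-embedded (conclusion of
TrumpetKIDRigidity), leaf-adapted late model charts Φᵢ : Uᵢ → 𝒟.carrier (smooth, open embeddings of
{x⁰ > τ₀}, slab {x⁰ = t} into the leaf F({t} × X), images in J⁺(ιX)) with proper truncations ρᵢ and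
radii Rᵢ(t) → ∞ along which the C² truncated deviation → 0, pairwise disjoint truncated tubes
eventually, a leaf-adapted flat chart Φ₀ on U₀ ⊇ {τ₀ < t, ςᵢ(t) < |y − ξᵢ(t)| ∀ i} (ςᵢ sublinear,
ξᵢ(t) = t vᵢ + o(t), |vᵢ| < 1) with C² deviation from η → 0, and EXHAUSTION ((J⁺(ιX) ∩ I⁻(Φ₀(late)))
∖ certifiedLate(t₁) ⊆ J⁻(certifiedSlab(t₁)) for all t₁ > τ₀), then ∃ O d with sub-extremal
parameters, O = exteriorOf 𝒟 d.charted and HasExhaustiveCharts d (hole charts Φᵢ ∘ χᵢ⁻¹ ∘ boost⁻¹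
restricted and horizon-normalised to boosted Kerr–Schild exteriors; motions (boost vᵢ, 0); excision
radii from ςᵢ + o(t) + |aᵢ|; C² control transfers along the fixed χᵢ⁻¹ on compacta). [difficulty:
XL] [arXiv:2104.08222, arXiv:1710.01722, doi:10.1103/PhysRevD.98.044014]
#9 KerrTrumpetModel (support) — KERR TRUMPETS EXIST (card P1; anti-vacuity of the trumpet-model
clauses and the cheapest falsifier): for every sub-extremal (M,a) there is an x⁰-stationary vacuum
trumpet model (U, γ) satisfying every hypothesis of TrumpetKIDRigidity and Kerr-embedded with THESE
parameters — i.e. Kerr(M,a) admits a stationary slicing by complete maximal slices, regular across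
r₊, asymptotic to a T-invariant maximal cylinder in {r₋ < r < r₊}, lapse → 1 at the AF end and → 0
down the trumpet. Schwarzschild explicit (C = 3√3M²/4, r_c = 3M/2); Kerr numerically
(Dennison–Baumgarte–Montero); a quasilinear elliptic problem for the height function, kit-computable
first. [difficulty: L] [doi:10.1103/PhysRevD.7.2814, arXiv:gr-qc/0701037,
doi:10.1103/PhysRevLett.113.261101, doi:10.1103/PhysRevD.57.4728]
#9 WeakCosmicCensorship (support) — THE SHARED CONJUNCT (weak cosmic censorship in the typed form,
for cross-route deduplication; implied by MaximalCensorship via monotonicity of genericity; not used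
by `closes`): for Christodoulou-generic admissible data an MGHD exists and every MGHD has complete
future null infinity. [difficulty: open-problem] [Christodoulou1999, arXiv:0811.0354,
arXiv:1710.01722]

TWO-LAYER PLAN. Foreseen glued splits (k ≤ 3, depth 1; only the first is prepared now).
SettlingInMaximalGauge ⇐ TrumpetLimits → TrumpetKIDRigidity →
SliceDictionary → SettlingInMaximalGauge, where TrumpetLimits (card K2 ⊕ K4: along the foliation,
pointed C² limits at the separating wells
exist and are x⁰-stationary vacuum trumpet models — the hypotheses of TrumpetKIDRigidity verbatim —
in leaf-adapted model charts with
proper truncations and growing radii, far limit flat in a leaf-adapted chart on the late half-space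
minus sublinear tubes around straight
subluminal tracks, wells separate, certified zones exhaust J⁺(ιX) ∩ I⁻(far zone); its conclusion is
SliceDictionary's hypothesis with
"Kerr-embedded" replaced by "trumpet model") is filed informal right after open (its typed form is
5.6k chars > the 4k signature cap)
and gets its signature once the definition items IsNormalisedMaximalFoliation / IsTrumpetModel /
LeafAdaptedModelCharts land; the glue is
then literal. MaximalCensorship ⇐ (MaximalWCC: generic complete 𝓘⁺ + one complete maximal Cauchy
leaf, Bartnik) → (SingularityAvoidance:
a maximal Cauchy leaf of an MGHD with complete 𝓘⁺ propagates to a normalised maximal Cauchy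
foliation for all later times — the
limit-cylinder theorem) → (TrappedWellsGeneric) → MaximalCensorship. TrumpetKIDRigidity ⇐
(StaticCase: Bunting–Masood on the R ≥ 0 slab) →
(AxisymmetricOrNearKerr: Carter–Robinson / AIK with the trumpet end as inner boundary) → (general
smooth case).

KILL CRITERIA. - KerrTrumpetModel REFUTED for some sub-extremal a ≠ 0 (no stationary maximal trumpet
slicing of Kerr regular across r₊ with a limit cylinder
  in {r₋ < r < r₊}): the limit objects do not exist for rotating holes; TrumpetLimits is unfileable
and SettlingInMaximalGauge loses its
  mechanism — close `refuted:TrumpetKIDRigidity`-branch by pivoting the route to a different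
limit-slice class or close it outright.
- TrumpetKIDRigidity refuted by an explicit non-Kerr stationary vacuum trumpet model: smooth no-hair
fails — summit-level event; close
  `refuted:TrumpetKIDRigidity`, witness to the negatives index (kills every stationary-limit route).
- MaximalCensorship refuted AS TYPED (e.g. complete maximal Cauchy leaves of Kerr a ≠ 0 developments
cannot exist for all late times, or the
  normalisation/AF clauses are unsatisfiable even for Schwarzschild data): `--restate` to the
corrected leaf class; the line survives iff
  singularity avoidance survives in some form; otherwise close `refuted:MaximalCensorship`.
- TrappedWellsSubextremal refuted (trapped wells compatible with an extremal remnant): restate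
MaximalCensorship (iii) with the refuter's
  sharper slice-level third law, or add the decomposition-level clause "no exhaustive decomposition
has an extremal hole" to the generic crux.
- SettlingInMaximalGauge refuted by an admissible datum with complete 𝓘⁺ and trapped wells that
never settles: the conjecture itself is in
  doubt (file ¬FinalStateConjecture with the tenure planner). A proof of FinalStateConjecture by
another route supersedes this one.

NOT DECOMPOSED YET. - TrumpetLimits (typed): waits for the definition items (4k signature cap);
filed informal at open; see Two-layer plan.
- T2 upgrade of the layer-2 plan (route-repair 2026-08-16): SliceDictionary (support) still
concludes the pre-T2 pair (O = exteriorOf,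
  HasExhaustiveCharts); RaysStayInClosure (Cauchy leaves + complete 𝓘⁺: a future-complete normalised
null ray crosses every late leaf, in
  the closure of the chronological past of its charted part) and IsFutureOriented (∂ₜF
future-pointing, boosts orthochronous) enter
  TrumpetLimits / SliceDictionary when the split is filed; the MaximalCensorship (ii) topology
defect (non-PSC X) and the universal
  quantification of TrappedWellsSubextremal over ALL exhaustive decompositions (rather than the one
produced by SettlingInMaximalGauge;
  late chart images do lie in O ⊆ J⁺(ιX) by `IsLateChart`) await tenure.
- The lapse-well census (components of {N_t < ε} eventually constant, mutual distances → ∞): inside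
TrumpetLimits.
- R_h = |k|² ≥ 0 and the Bray/Huisken–Ilmanen neck bound A ≤ 16πM² on every leaf (card P2): lemmas a
prover attaches with
  `--supports SettlingInMaximalGauge`, not items.
- The no-soliton statement for the far limit, horizon normalisation of Kerr–Schild hole charts, the
o(t) bookkeeping of excision radii:
  inside TrumpetLimits / SliceDictionary.
- Schwarzschild / Oppenheimer–Snyder-type sanity instance (card P4) and the Reissner–Nordström
proxy: refuter calibrations, not items.

CHEAPEST FALSIFIER. KerrTrumpetModel at a ≠ 0: solve the stationary maximal-slicing height-function
equation for Kerr (axisymmetric quasilinear elliptic PDE for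
t_BL = x⁰/c + H(r, θ); first the ODE truncations on the axis and the equator) and check that a
solution regular across r₊ asymptotes to a
T-invariant maximal cylinder r = r_c(a, θ) with r₋ < r_c < r₊ and lapse → 0 there
(Dennison–Baumgarte–Montero report such slices
numerically, doi:10.1103/PhysRevLett.113.261101; Schwarzschild is explicit, r_c = 3M/2). If for some
sub-extremal a every candidate runs
into the Cauchy horizon or turns null, the trumpet limit objects do not exist and the mechanism of
cruxes 3 and 5 dies at once. Not run in
this plancard seat (no kit job prepared); second cheap check: Beig–Ó Murchadha's late-time analysis
redone for Reissner–Nordström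
(non-crushing inner horizon, r_c = (3M + √(9M² − 8Q²))/4 > r₋) as the a ≠ 0 proxy, and the extremal
limit Q → M (r_c → r₊) as the
calibration of TrappedWellsSubextremal.

NUMBERS. - Schwarzschild maximal trumpet: limit cylinder r_c = 3M/2, C = 3√3 M²/4, throat lapse ~
exp(−t/τ) with τ = 3√6 M/4 ≈ 1.84 M
  (doi:10.1103/PhysRevD.57.4728); analytic trumpet lapse α = √(1 − 2M/R + 27M⁴/(16R⁴))
(arXiv:gr-qc/0701037).
- Reissner–Nordström proxy: r_c(Q) = (3M + √(9M² − 8Q²))/4 ∈ (M, 3M/2], = r₊ = M exactly at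
extremality (trumpet degenerates into the
  extremal throat: the slice-level third law behind TrappedWellsSubextremal).
- Riemannian Penrose on every leaf (R = |k|² ≥ 0): outermost minimal-surface area ≤ 16π M_ADM² — the
all-time a-priori neck bound.
- Items at open: 8 (4 cruxes, 3 support, 1 assembly); signature lengths 1899 / 2033 / 2081 / 2290 /
3033 / 2290 / 427 / 98 chars (cap 4000).
- Route-repair 2026-08-16 (Statement re-type T2): MaximalCensorship restated (IsChristodoulouGeneric
→ IsTameChristodoulouGeneric, 1903
  chars), SettlingInMaximalGauge restated (conclusion += RaysStayInClosure, IsFutureOriented; 2154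
chars); deciding theorem crux-only with
  4 hypotheses (MaximalCensorship, SettlingInMaximalGauge, TrappedWellsSubextremal,
TrumpetKIDRigidity), lean check rc 0, audit ok.

DEFINITION REQUESTS. - `IsNormalisedMaximalFoliation 𝒟 F ν` with `lapseOf 𝒟 F ν t x := −g(∂ₜF, ν)`
(topic Summits/FinalStateConjecture/FinalStateConjecture/Theorems):
  clause (ii) of MaximalCensorship verbatim (its inline copy appears in three items).
- `IsTrumpetModel (U : Opens E4) (γ : LorentzianMetric 𝓘(ℝ,E4) ∞ U)` and `IsKerrEmbeddedStationary U
γ` (same topic): hypotheses /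
  conclusion of TrumpetKIDRigidity verbatim.
- `LeafAdaptedModelCharts 𝒟 F n U γ b ρ Φ R U₀ Φ₀ τ₀ ξ v ς` (same topic): the chart / convergence /
separation / far-zone / exhaustion
  clauses of SliceDictionary's hypothesis verbatim — needed to type TrumpetLimits under the 4k cap.
- `KillingInitialData (h, k, N, Y)` (topic Literature/Geometry/Lorentzian; Beig–Chruściel
arXiv:gr-qc/9604040) for the Riemannian
  restatement of TrumpetKIDRigidity à la Bunting–Masood; cite facts wanted: Beig–Ó Murchadha
doi:10.1103/PhysRevD.57.4728 §IV and
  Bartnik doi:10.1007/bf01209300 Thm 4.1 as Literature named facts.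
Filed right after open with `ledger workitem add --kind definition … --for <TrumpetLimits id>`
(first three).

Novelty: Searches (2026-08-15, this seat, on top of the card's): `lit search --hybrid "maximal slicing
collapse of the lapse trumpet limit surface
Schwarzschild"` (8 docs: Baumgarte–Shapiro 2021 pp. 110–119 held, Rendall 2008 held — read pp. 60,
221, 242: maximal hypersurfaces
"global in space", CMC foliations vs censorship); `lit galaxy search "trumpet slices" --star all` (4
pdf hits: Slinker–Evans–Hannam boosted
trumpets doi:10.1103/PhysRevD.98.044014, a Lisbon MSc thesis, two unrelated); `lit galaxy search
"stationary maximal slicing trumpet" --star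
all` (0); `lit search --source zbmath` ×5: "maximal slicing Schwarzschild late time" (1: Reimann
gr-qc/0405016), "trumpet slices Kerr
maximal slicing" (0), "Killing initial data Beig Chrusciel" (4: gr-qc/9604040, gr-qc/0403042,
gr-qc/9510015), "constant mean curvature
foliation cosmic censorship global existence" (3: Rendall gr-qc/9608045, Wang arXiv:1004.2938),
"Existence of maximal surfaces … Bartnik"
(doi:10.1007/bf01209300); `lit frontier FinalStateConjecture --since 2021` (30 rows; nearest:
arXiv:2409.14582 trapped surfaces in
geodesic foliation, arXiv:2601.01517 multi-black-hole Cauchy data — none in maximal gauge); `lit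
bridges FinalStateConjecture --cross any`
(surveys only); arXiv/OpenAlex legs unavailable (rc 3 / HTTP 429). Ledger: no Theses for this
summit, 101 cards read by title, negatives
index empty.
Nearest prior art found: doi:10.1103/PhysRevD.57.4728 (Beig–Ó Murchadha: rigorous late-time maximal
slicing, Schwarzschild  [refs: 10.1103/PhysRevD.98.044014, 10.1007/bf01209300, 10.1103/PhysRevD.57.4728, 10.1103/PhysRevD.78.064020, 10.1103/PhysRevLett.113.261101, 1004.2938, 2409.14582, 2601.01517, gr-qc/9604040, doi:10.1103/PhysRevD.98.044014, doi:10.1007/bf01209300, doi:10.1103/PhysRevD.57.4728, doi:10.1103/PhysRevD.78.064020, doi:10.1103/PhysRevLett.113.261101, ChristodoulouKlainerman1993]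

Barriers (technique_class: elliptic-gauge, maximal-foliation, KID-limit): - technique_class: elliptic-gauge, maximal-foliation, KID-limit
- Literature.Barriers.FinalStateConjecture.IonescuKlainermanNonExtension: it does not evade it —
TrumpetKIDRigidity contains smooth stationary uniqueness for holes with trumpet slicings; the bet is
that the maximal-slab structure (R = |k|² ≥ 0, one AF end, trapped cylindrical end with dying lapse)
admits a Riemannian Bunting–Masood-type argument, with the static and near-Kerr (AIK) cases as
honest first children; the crux says so in its why-line.
- Literature.Barriers.FinalStateConjecture.SbierskiTrappingObstruction: bites on
SettlingInMaximalGauge / TrumpetLimits exactly as on every decay statement (derivative loss at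
trapping is gauge-blind); no estimate without loss is claimed — the items are rate-free C²
convergence.
- Literature.Barriers.FinalStateConjecture.KerrSuperradiance: same — superradiant amplification must
be absorbed inside SettlingInMaximalGauge; maximal gauge neither helps nor hurts; the route concedes
it adds no difficulty at best (no gauge drift, elliptic N, β).
- Literature.Barriers.FinalStateConjecture.SlowlyRotatingKerrFrontier: the perturbative regime
enters only through whichever capture theorem a prover uses inside SettlingInMaximalGauge near each
well; the items are stated for all |a| < M and do not presuppose small a.
- Literature.Barriers.FinalStateConjecture.AretakisInstability: evaded by design — extremal remnants
violate clause (iii) of MaximalCensorship (an extremal throat has smal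

History (route lifecycle, newest last):
- 2026-08-15T15:21:05Z · rev 1: dropped stmt-FinalStateConjecture-10190 — drop accidental duplicate placeholder item (informal text 'probe') created by a mistyped CLI call; the real informal crux TrumpetLimits is stmt-FinalStateConjec (planner-plancard-FinalStateConjecture-FinalSt-18b7d3ec-0)
- 2026-08-16T23:47:32Z · rev 4: restated MaximalCensorship (stmt-FinalStateConjecture-10158), SettlingInMaximalGauge (stmt-FinalStateConjecture-10159) — route-repair (glue.unproved after the Statement re-type T2 of 2026-08-16: `IsChristodoulouGeneric` → `IsTameChristodoulouGeneric`, per-development clause += Ray (planner-rbadge-FinalStateConjecture-LapseTrump-731f1007-g2-0)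
- 2026-08-17T00:27:20Z · rev 7: restated Assembly (stmt-FinalStateConjecture-10165) — route-repair g3 (glue stamp, cont.): the closes-only re-submission (rev 5, 00:24:48Z) was recorded glue.ok=provisional / authority=textual with no native pass ( (planner-rbadge-FinalStateConjecture-LapseTrump-731f1007-g3-0)
- 2026-08-23T10:32:59Z · DORMANT — reconciler: no traction for 6.1 d (last activity statement-grounded at 2026-08-17T08:08:36Z); parked, not closed — `ledger route dormant route-FinalStateConject (operator:999:1186438)

sub-problem: FinalStateConjecture · status: dormant · opened planner-plancard-FinalStateConjecture-FinalSt-18b7d3ec-0 2026-08-15T15:14:57Z · rev 7 · ledger route-FinalStateConjecture-LapseTrumpetKID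
GENERATED by the gate from the ledger (D-0016/17). Provers cite these decls: `theorem foo : Summit.FinalStateConjecture.FinalStateConjecture.Theses.LapseTrumpetKID.<Decl> := …` in Summits/FinalStateConjecture/FinalStateConjecture/Theorems/<Name>.lean.
-/

namespace Summit.FinalStateConjecture.FinalStateConjecture.Theses.LapseTrumpetKID

open scoped BigOperators Topology Manifold Classical MeasureTheory ProbabilityTheory Matrix InnerProductSpace ComplexConjugate ContinuousMap
open Filter Set Function TopologicalSpace MeasureTheory

attribute [summit_statement] _root_.FinalStateConjecture

-- earlier MaximalCensorship (stmt-FinalStateConjecture-10158, replaced 2026-08-16T23:47:32Z -> stmt-FinalStateConjecture-17998): retired by None — open Literature.Geometry.Lorentzian in ∀ (X : Type) [TopologicalSpace X] [ChartedSpace E3 X] [IsManifold (𝓡 3) (⊤ : ℕ∞) X] [T2Space X] [SecondCountableTopology X] [ConnectedSpace X], InitialDataSet.IsChristodoulouGeneric (admissibleVacuumData X) (fun D ↦ 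
/-- item stmt-FinalStateConjecture-17998 · crux · rank 2 · open · by planner
why it might fail: Likely FALSE as typed (∀ X): on X=T³∖{p} admissible vacuum data exist (IMP gr-qc/0206034 Thm 1) yet no AF Cauchy leaf ≅X is maximal (R=|k|²≥0 ⇒ T³ PSC; ibid. Thm 4), so (ii) fails on all of 𝓓≠∅. On ℝ³: WCC + all-time maximal gauge (Moncrief–Eardley), open for a≠0; tame witnesses needed.
sources: arXiv:gr-qc/0206034, doi:10.1007/BF01647970, doi:10.1103/PhysRevLett.57.1386, doi:10.1103/PhysRevD.57.4728, doi:10.1007/bf01209300, Christodoulou1999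
[crux] GENERIC CLAUSE (card K1 ⊕ the WCC conjunct ⊕ trapping of wells; the only item stated for
generic data; route-repair 2026-08-16: genericity re-typed to the audited Statement's TAME notion
`InitialDataSet.IsTameChristodoulouGeneric … 1` — through every exceptional admissible datum passes
an injective one-parameter admissible family, tame on ONE fixed AF end (DR rates, continuous mass,
wDist-continuous at 0) and immersed at 0, all of whose other members satisfy the property): for
tame-Christodoulou-generic admissible D an MGHD exists and every MGHD 𝒟 (i) has complete 𝓘⁺
(`HasCompleteNullInfinity`); (ii) carries a normalised maximal Cauchy foliation — F : ℝ × X →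
𝒟.carrier smooth with future unit normals ν; every x ↦ F(t,x) a smooth embedding onto a Cauchy
hypersurface; the induced (h,k) agree with an InitialDataSet on X that is maximal (tr k = 0),
complete, asymptotically flat of order 1 with a sole end; lapse N = −g(∂ₜF, ν) > 0 everywhere and
N(t,·) → 1 cocompactly for t ≥ 0; (iii) WELLS TRAPPED: ∃ ε > 0, t₀ such that t ≥ t₀, N(t,x) < ε, t'
≥ t, N(t',x') > 1 − ε ⇒ F(t',x') ∉ J⁺(F(t,x)). [difficulty: open-problem] -/
@[route_item "route-FinalStateConjecture-LapseTrumpetKID", crux]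
def MaximalCensorship : Prop :=
  open Literature.Geometry.Lorentzian in ∀ (X : Type) [TopologicalSpace X] [ChartedSpace E3 X] [IsManifold (𝓡 3) (⊤ : ℕ∞) X] [T2Space X] [SecondCountableTopology X] [ConnectedSpace X], InitialDataSet.IsTameChristodoulouGeneric (admissibleVacuumData X) (fun D ↦ (∃ 𝒟 : VacuumCauchyDevelopment D, 𝒟.IsMaximal) ∧ ∀ 𝒟 : VacuumCauchyDevelopment D, 𝒟.IsMaximal → Summit.FinalStateConjecture.HasCompleteNullInfinity 𝒟.toCauchyDevelopment ∧ ∃ (F : ℝ × X → 𝒟.carrier) (ν : ∀ t : ℝ, NormalField (𝓡 4) (fun x : X ↦ F (t, x))), (ContMDiff (𝓘(ℝ, ℝ).prod (𝓡 3)) (𝓡 4) (⊤ : ℕ∞) F ∧ (∀ t, Manifold.IsSmoothEmbedding (𝓡 3) (𝓡 4) (⊤ : ℕ∞) (fun x ↦ F (t, x))) ∧ (∀ t, 𝒟.metric.IsCauchyHypersurface 𝒟.timeOrientation (range fun x ↦ F (t, x))) ∧ (∀ t, 𝒟.metric.IsFutureUnitNormal (𝓡 3) 𝒟.timeOrientation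 (fun x ↦ F (t, x)) (ν t)) ∧ (∀ t, ∃ Dt : InitialDataSet (𝓡 3) X, (∀ (x : X) (v w : TangentSpace (𝓡 3) x), Dt.h.inner x v w = 𝒟.metric.val (F (t, x)) (mfderiv (𝓡 3) (𝓡 4) (fun y ↦ F (t, y)) x v) (mfderiv (𝓡 3) (𝓡 4) (fun y ↦ F (t, y)) x w)) ∧ (∀ [𝒟.metric.toPseudoRiemannianMetric.HasLeviCivita] (x : X), 𝒟.metric.toPseudoRiemannianMetric.secondFundamentalForm (𝓡 3) (fun y ↦ F (t, y)) (ν t) x = Dt.kBilin x) ∧ Dt.IsMaximalData ∧ (∀ [Dt.metric.HasLeviCivita], Dt.IsComplete) ∧ ∃ e : AFEnd X, e.IsSoleEnd ∧ e.IsAsymptoticallyFlat Dt 1) ∧ (∀ t x, 0 < - 𝒟.metric.val (F (t, x)) (mfderiv 𝓘(ℝ, ℝ) (𝓡 4) (fun s : ℝ ↦ F (s, x)) t 1) (ν t x)) ∧ (∀ t, 0 ≤ t → Tendsto (fun x ↦ - 𝒟.metric.val (F (t, x)) (mfderiv 𝓘(ℝ, ℝ) (𝓡 4) (fun s : ℝ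 ↦ F (s, x)) t 1) (ν t x)) (cocompact X) (𝓝 1))) ∧ (∃ ε : ℝ, 0 < ε ∧ ∃ t₀ : ℝ, ∀ (t : ℝ) (x : X), t₀ ≤ t → - 𝒟.metric.val (F (t, x)) (mfderiv 𝓘(ℝ, ℝ) (𝓡 4) (fun s : ℝ ↦ F (s, x)) t 1) (ν t x) < ε → ∀ (t' : ℝ) (x' : X), t ≤ t' → 1 - ε < - 𝒟.metric.val (F (t', x')) (mfderiv 𝓘(ℝ, ℝ) (𝓡 4) (fun s : ℝ ↦ F (s, x')) t' 1) (ν t' x') → F (t', x') ∉ 𝒟.metric.causalFuture 𝒟.timeOrientation {F (t, x)})) 1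

-- earlier SettlingInMaximalGauge (stmt-FinalStateConjecture-10159, replaced 2026-08-16T23:47:32Z -> stmt-FinalStateConjecture-17999): retired by None — open Literature.Geometry.Lorentzian in ∀ (X : Type) [TopologicalSpace X] [ChartedSpace E3 X] [IsManifold (𝓡 3) (⊤ : ℕ∞) X] [T2Space X] [SecondCountableTopology X] [ConnectedSpace X] (D : InitialDataSet (𝓡 3) X), D ∈ admissibleVacuumData X → ∀ 𝒟 : Vac
/-- item stmt-FinalStateConjecture-17999 · crux · rank 3 · open · by planner
why it might fail: Deterministic large-data half of the conjecture for EVERY admissible datum, given only the gauge: nonlinear Kerr stability known only for |a|≪M (2104.11857, 2205.14808); nothing excludes perpetual radiation, infinitely many late mergers or a non-Kerr stationary end-state; T2 adds rays-in-closure.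
sources: ChristodoulouKlainerman1993, arXiv:2104.11857, arXiv:2205.14808, arXiv:0811.0354, doi:10.1103/PhysRevD.57.4728, doi:10.1103/PhysRevD.78.064020
[crux] SETTLING ALONG THE MAXIMAL FOLIATION (card K2 ⊕ K3 ⊕ K4 ⊕ P3 as ONE layer-1 node;
deterministic, ALL admissible D; route-repair 2026-08-16: conclusion re-typed to the audited
Statement's per-development clause, re-type T2): if an MGHD 𝒟 of an admissible datum has complete 𝓘⁺
and carries a normalised maximal Cauchy foliation (F, ν) with trapped wells (clauses (ii)–(iii) of
MaximalCensorship verbatim), then there are O and a typed `FinalStateDecomposition 𝒟.toSpacetime O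
2` (finitely many boosted Kerr exteriors with |aᵢ| ≤ Mᵢ, a flat radiation chart, separation,
sublinear excision) with O = exteriorOf 𝒟 d.charted, `RaysStayInClosure 𝒟 O` (every future-complete
normalised null ray from the data stays in closure O: the settled region is not the witness's to
choose), `HasExhaustiveCharts d` (honest radii Rᵢ ≥ max(r₊,0)+1, Rᵢ → ∞, exhaustion of O for every
chart time) and `IsFutureOriented d` (orthochronous motions; chart time is the g-future). Intended
proof = its layer-2 split: TrumpetLimits (pointed C² limits of the leaves at the separating wells
exist and are x⁰-stationary vacuum trumpet models, far limit flat, census finite, certified zones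
exhaustive; Cauchy leaves + complet -/
@[route_item "route-FinalStateConjecture-LapseTrumpetKID", crux]
def SettlingInMaximalGauge : Prop :=
  open Literature.Geometry.Lorentzian in ∀ (X : Type) [TopologicalSpace X] [ChartedSpace E3 X] [IsManifold (𝓡 3) (⊤ : ℕ∞) X] [T2Space X] [SecondCountableTopology X] [ConnectedSpace X] (D : InitialDataSet (𝓡 3) X), D ∈ admissibleVacuumData X → ∀ 𝒟 : VacuumCauchyDevelopment D, 𝒟.IsMaximal → Summit.FinalStateConjecture.HasCompleteNullInfinity 𝒟.toCauchyDevelopment → ∀ (F : ℝ × X → 𝒟.carrier) (ν : ∀ t : ℝ, NormalField (𝓡 4) (fun x : X ↦ F (t, x))), (ContMDiff (𝓘(ℝ, ℝ).prod (𝓡 3)) (𝓡 4) (⊤ : ℕ∞) F ∧ (∀ t, Manifold.IsSmoothEmbedding (𝓡 3) (𝓡 4) (⊤ : ℕ∞) (fun x ↦ F (t, x))) ∧ (∀ t, 𝒟.metric.IsCauchyHypersurface 𝒟.timeOrientation (range fun x ↦ F (t, x))) ∧ (∀ t, 𝒟.metric.IsFutureUnitNormal (𝓡 3) 𝒟.timeOrientation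 (fun x ↦ F (t, x)) (ν t)) ∧ (∀ t, ∃ Dt : InitialDataSet (𝓡 3) X, (∀ (x : X) (v w : TangentSpace (𝓡 3) x), Dt.h.inner x v w = 𝒟.metric.val (F (t, x)) (mfderiv (𝓡 3) (𝓡 4) (fun y ↦ F (t, y)) x v) (mfderiv (𝓡 3) (𝓡 4) (fun y ↦ F (t, y)) x w)) ∧ (∀ [𝒟.metric.toPseudoRiemannianMetric.HasLeviCivita] (x : X), 𝒟.metric.toPseudoRiemannianMetric.secondFundamentalForm (𝓡 3) (fun y ↦ F (t, y)) (ν t) x = Dt.kBilin x) ∧ Dt.IsMaximalData ∧ (∀ [Dt.metric.HasLeviCivita], Dt.IsComplete) ∧ ∃ e : AFEnd X, e.IsSoleEnd ∧ e.IsAsymptoticallyFlat Dt 1) ∧ (∀ t x, 0 < - 𝒟.metric.val (F (t, x)) (mfderiv 𝓘(ℝ, ℝ) (𝓡 4) (fun s : ℝ ↦ F (s, x)) t 1) (ν t x)) ∧ (∀ t, 0 ≤ t → Tendsto (fun x ↦ - 𝒟.metric.val (F (t, x)) (mfderiv 𝓘(ℝ, ℝ) (𝓡 4) (fun s : ℝ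 ↦ F (s, x)) t 1) (ν t x)) (cocompact X) (𝓝 1))) → (∃ ε : ℝ, 0 < ε ∧ ∃ t₀ : ℝ, ∀ (t : ℝ) (x : X), t₀ ≤ t → - 𝒟.metric.val (F (t, x)) (mfderiv 𝓘(ℝ, ℝ) (𝓡 4) (fun s : ℝ ↦ F (s, x)) t 1) (ν t x) < ε → ∀ (t' : ℝ) (x' : X), t ≤ t' → 1 - ε < - 𝒟.metric.val (F (t', x')) (mfderiv 𝓘(ℝ, ℝ) (𝓡 4) (fun s : ℝ ↦ F (s, x')) t' 1) (ν t' x') → F (t', x') ∉ 𝒟.metric.causalFuture 𝒟.timeOrientation {F (t, x)}) → ∃ (O : Set 𝒟.carrier) (d : FinalStateDecomposition 𝒟.toSpacetime O 2), O = Summit.FinalStateConjecture.exteriorOf 𝒟.toCauchyDevelopment d.charted ∧ Summit.FinalStateConjecture.RaysStayInClosure 𝒟.toCauchyDevelopment O ∧ Summit.FinalStateConjecture.HasExhaustiveCharts d ∧ Summit.FinalStateConjecture.IsFutureOriented d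

/-- item stmt-FinalStateConjecture-10160 · crux · rank 4 · open · by planner
why it might fail: Unproved slice-level third law for ALL data: needs 'near zone → |a|=M ⇒ late maximal leaves have N<ε OUTSIDE the horizon'. Extremal horizons form in finite time (Kehle–Unger 2211.15742); extremal RN, f=(1−M/r)², has no interior maximal cylinder, so pile-up locus and exterior lapse floor are open.
sources: arXiv:2211.15742, arXiv:1710.01722, doi:10.1103/PhysRevD.57.4728, Literature.Barriers.FinalStateConjecture.AretakisInstability
[crux] THE THIRD LAW IN SLICE FORM (deterministic): for an admissible D, an MGHD with complete 𝓘⁺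
and a normalised maximal Cauchy foliation with trapped wells (clauses (ii)–(iii) verbatim), EVERY
typed exhaustive decomposition (O = exteriorOf 𝒟 d.charted, HasExhaustiveCharts d) has sub-extremal
holes, |aᵢ| < Mᵢ for all i: an extremal remnant would carry a lapse well down its throat OUTSIDE the
horizon, i.e. an untrapped well. Supplies the Statement's `Kerr.IsSubextremal` clause without a
separate generic crux. [deps: MaximalCensorship] [difficulty: L] -/
@[route_item "route-FinalStateConjecture-LapseTrumpetKID", crux]
def TrappedWellsSubextremal : Prop :=
  open Literature.Geometry.Lorentzian in ∀ (X : Type) [TopologicalSpace X] [ChartedSpace E3 X] [IsManifold (𝓡 3) (⊤ : ℕ∞) X] [T2Space X] [SecondCountableTopology X] [ConnectedSpace X] (D : InitialDataSet (𝓡 3) X), D ∈ admissibleVacuumData X → ∀ 𝒟 : VacuumCauchyDevelopment D, 𝒟.IsMaximal → Summit.FinalStateConjecture.HasCompleteNullInfinity 𝒟.toCauchyDevelopment → ∀ (F : ℝ × X → 𝒟.carrier) (ν : ∀ t : ℝ, NormalField (𝓡 4) (fun x : X ↦ F (t, x))), (ContMDiff (𝓘(ℝ, ℝ).prod (𝓡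 3)) (𝓡 4) (⊤ : ℕ∞) F ∧ (∀ t, Manifold.IsSmoothEmbedding (𝓡 3) (𝓡 4) (⊤ : ℕ∞) (fun x ↦ F (t, x))) ∧ (∀ t, 𝒟.metric.IsCauchyHypersurface 𝒟.timeOrientation (range fun x ↦ F (t, x))) ∧ (∀ t, 𝒟.metric.IsFutureUnitNormal (𝓡 3) 𝒟.timeOrientation (fun x ↦ F (t, x)) (ν t)) ∧ (∀ t, ∃ Dt : InitialDataSet (𝓡 3) X, (∀ (x : X) (v w : TangentSpace (𝓡 3) x), Dt.h.inner x v w = 𝒟.metric.val (F (t, x)) (mfderiv (𝓡 3) (𝓡 4) (fun y ↦ F (t, y)) x v) (mfderiv (𝓡 3) (𝓡 4) (fun y ↦ F (t, y)) x w)) ∧ (∀ [𝒟.metric.toPseudoRiemannianMetric.HasLeviCivita] (x : X), 𝒟.metric.toPseudoRiemannianMetric.secondFundamentalForm (𝓡 3) (fun y ↦ F (t, y)) (ν t) x = Dt.kBilin x) ∧ Dt.IsMaximalData ∧ (∀ [Dt.metric.HasLeviCivita], Dt.IsComplete) ∧ ∃ e : AFEnd X, e.IsSoleEnd ∧ e.IsAsymptoticallyFlat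 Dt 1) ∧ (∀ t x, 0 < - 𝒟.metric.val (F (t, x)) (mfderiv 𝓘(ℝ, ℝ) (𝓡 4) (fun s : ℝ ↦ F (s, x)) t 1) (ν t x)) ∧ (∀ t, 0 ≤ t → Tendsto (fun x ↦ - 𝒟.metric.val (F (t, x)) (mfderiv 𝓘(ℝ, ℝ) (𝓡 4) (fun s : ℝ ↦ F (s, x)) t 1) (ν t x)) (cocompact X) (𝓝 1))) → (∃ ε : ℝ, 0 < ε ∧ ∃ t₀ : ℝ, ∀ (t : ℝ) (x : X), t₀ ≤ t → - 𝒟.metric.val (F (t, x)) (mfderiv 𝓘(ℝ, ℝ) (𝓡 4) (fun s : ℝ ↦ F (s, x)) t 1) (ν t x) < ε → ∀ (t' : ℝ) (x' : X), t ≤ t' → 1 - ε < - 𝒟.metric.val (F (t', x')) (mfderiv 𝓘(ℝ, ℝ) (𝓡 4) (fun s : ℝ ↦ F (s, x')) t' 1) (ν t' x') → F (t', x') ∉ 𝒟.metric.causalFuture 𝒟.timeOrientation {F (t, x)}) → ∀ (O : Set 𝒟.carrier) (d : FinalStateDecomposition 𝒟.toSpacetime O 2), O = Summit.FinalStateConjecture.exteriorOf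 𝒟.toCauchyDevelopment d.charted → Summit.FinalStateConjecture.HasExhaustiveCharts d → ∀ i, Kerr.IsSubextremal (d.mass i) (d.spin i)

/-- item stmt-FinalStateConjecture-10161 · crux · rank 5 · open · by planner
why it might fail: = smooth non-analytic stationary vacuum BH uniqueness: proved only if analytic (Chruściel–Costa), static (Bunting–Masood) or near Kerr (AIK 0904.0982); IK 1108.3575 bars local Killing extension; horizon seen only via the trapped dying-lapse end; a smooth non-Kerr stationary trumpet KID kills it.
sources: ChruscielCosta2008, arXiv:0904.0982, arXiv:1108.3575, doi:10.1007/BF00770326, arXiv:gr-qc/9604040, Literature.Barriers.FinalStateConjecture.IonescuKlainermanNonExtension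
[crux] TRUMPET-KID RIGIDITY (card K3, spacetime form; the identification child of
SettlingInMaximalGauge, typed now): an x⁰-stationary vacuum trumpet model — U ⊆ ℝ⁴ open and
∂₀-invariant, γ a C^∞ Lorentzian metric invariant under x⁰-translation, Ricci-flat, γ(∂₀,∂₀) bounded
above; the slab V = U ∩ {x⁰ = 0} ≅ ℝ³∖{0} with unit normal carrying induced data that form a
complete maximal InitialDataSet, asymptotically flat of order 1 at an end e where the model lapse
−γ(∂₀,ν) → 1; lapse > 0, → 0 off e outside compacts; small-lapse points unable to causally reach the
tube over the far part of e (any time orientation making ν future) — embeds into SUB-EXTREMAL Kerr: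
∃ (M,a), |a| < M, c > 0, a smooth injective χ : U → ℝ⁴ with χ(U) ⊆ {r > 0}, χ(U) ⊇ {r > r₁} for some
r₁ < r₊, χ^*(Kerr–Schild g_{M,a}) = γ and χ(x + s e₀) = χ(x) + c s e₀. (Killing development of a
trumpet KID = a T-invariant region {r > r_c(θ)} of Kerr; the trapped dying-lapse end excludes
extremal throats, white-hole trumpets and solitons; the AF end excludes NUT charge.) [difficulty:
open-problem] -/
@[route_item "route-FinalStateConjecture-LapseTrumpetKID", crux]
def TrumpetKIDRigidity : Prop :=
  open Literature.Geometry.Lorentzian in ∀ (U : Opens E4) (γ : LorentzianMetric 𝓘(ℝ, E4) (⊤ : ℕ∞) U), ((∀ x ∈ (U : Set E4), ∀ s : ℝ, x + s • E4.basisVector 0 ∈ (U : Set E4)) ∧ (∀ (x y : U) (s : ℝ), (y : E4) = (x : E4) + s • E4.basisVector 0 → ∀ v w : E4, γ.val y v w = γ.val x v w) ∧ (∀ [γ.toPseudoRiemannianMetric.HasLeviCivita], γ.toPseudoRiemannianMetric.IsRicciFlat) ∧ (∃ C : ℝ, ∀ x : U, γ.val x (E4.basisVector 0) (E4.basisVector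 0) ≤ C) ∧ ∃ (V : Opens E3) (σ : V → U) (νV : NormalField 𝓘(ℝ, E4) σ) (DV : InitialDataSet (𝓡 3) V) (e : AFEnd V), (V : Set E3) = {y | E4.ofTimeSpace 0 y ∈ (U : Set E4)} ∧ (∀ y, (σ y : E4) = E4.ofTimeSpace 0 y) ∧ γ.toPseudoRiemannianMetric.IsUnitNormal (𝓡 3) σ νV (-1) ∧ (∀ (y : V) (v w : TangentSpace (𝓡 3) y), DV.h.inner y v w = γ.val (σ y) (mfderiv (𝓡 3) 𝓘(ℝ, E4) σ y v) (mfderiv (𝓡 3) 𝓘(ℝ, E4) σ y w)) ∧ (∀ [γ.toPseudoRiemannianMetric.HasLeviCivita] (y : V), γ.toPseudoRiemannianMetric.secondFundamentalForm (𝓡 3) σ νV y = DV.kBilin y) ∧ DV.IsMaximalData ∧ (∀ [DV.metric.HasLeviCivita], DV.IsComplete) ∧ Nonempty (Diffeomorph (𝓡 3) (𝓡 3) V ((⟨({0} : Set E3)ᶜ, isOpen_compl_singleton⟩ : Opens E3)) (⊤ : ℕ∞)) ∧ e.IsAsymptoticallyFlat DV 1 ∧ (∀ y : V, 0 < - γ.val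 (σ y) (E4.basisVector 0) (νV y)) ∧ Tendsto (fun z : exteriorRegion e.R ↦ - γ.val (σ (e.dataChart z)) (E4.basisVector 0) (νV (e.dataChart z))) (comap (fun z : exteriorRegion e.R ↦ ‖(z : E3)‖) atTop) (𝓝 1) ∧ (∀ ε : ℝ, 0 < ε → ∃ K : Set V, IsCompact K ∧ ∀ y : V, y ∉ K → y ∉ (e.U : Set V) → - γ.val (σ y) (E4.basisVector 0) (νV y) < ε) ∧ (∃ ε : ℝ, 0 < ε ∧ ∃ R' : ℝ, ∀ τU : TimeOrientation γ, (∀ y : V, τU.IsFutureDirected (νV y)) → ∀ y : V, - γ.val (σ y) (E4.basisVector 0) (νV y) < ε → ∀ p : U, (∃ (z : V) (s : ℝ), z ∈ e.far R' ∧ (p : E4) = (σ z : E4) + s • E4.basisVector 0) → p ∉ γ.causalFuture τU {σ y})) → ∃ (Mk ak : ℝ), Kerr.IsSubextremal Mk ak ∧ ∃ c : ℝ, 0 < c ∧ ∃ χ : U → E4, ContMDiff 𝓘(ℝ, E4) 𝓘(ℝ, E4) (⊤ : ℕ∞) χ ∧ Injective χ ∧ (∀ x, χ x ∈ (Kerr.region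 ak 0 : Set E4)) ∧ (∃ r₁ : ℝ, r₁ < Kerr.rPlus Mk ak ∧ (Kerr.region ak r₁ : Set E4) ⊆ range χ) ∧ (∀ (x : U) (v w : E4), γ.val x v w = Kerr.bilin Mk ak (χ x) (mfderiv 𝓘(ℝ, E4) 𝓘(ℝ, E4) χ x v) (mfderiv 𝓘(ℝ, E4) 𝓘(ℝ, E4) χ x w)) ∧ (∀ (x y : U) (s : ℝ), (y : E4) = (x : E4) + s • E4.basisVector 0 → χ y = χ x + (c * s) • E4.basisVector 0)

-- item stmt-FinalStateConjecture-10187 · support · rank 6 · open · by planner — informal only, no Lean statement yet: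
--   [crux] TRUMPET LIMITS (card K2 ⊕ K4; the convergence child of SettlingInMaximalGauge, layer 2, to be
--   typed once the definition items IsNormalisedMaximalFoliation / IsTrumpetModel /
--   LeafAdaptedModelCharts land — its inline form is 5.6k chars > the 4k signature cap): for every
--   admissible D, every MGHD 𝒟 with complete 𝓘⁺ and every normalised maximal Cauchy foliation (F, ν)
--   with trapped wells (clauses (ii)-(iii) of MaximalCensorship), there are n ∈ ℕ, ∂₀-invariant opens Uᵢ
--   ⊆ ℝ⁴ with C^∞ Lorentzian γᵢ that are x⁰-STATIONARY VACUUM TRUMPET MODELS (the hypotheses of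
--   TrumpetKIDRigidity verbatim: stati

/-- item stmt-FinalStateConjecture-10162 · support · rank 9 · open · by planner
sources: arXiv:2104.08222, arXiv:1710.01722, doi:10.1103/PhysRevD.98.044014
[support] DICTIONARY TO THE TYPED STATEMENT (card P3; the glue child of SettlingInMaximalGauge,
typed now): for an admissible D, an MGHD 𝒟 and a map F : ℝ × X → 𝒟.carrier, if there are n,
∂₀-invariant models (Uᵢ ⊆ ℝ⁴, γᵢ) each Kerr-embedded (conclusion of TrumpetKIDRigidity),
leaf-adapted late model charts Φᵢ : Uᵢ → 𝒟.carrier (smooth, open embeddings of {x⁰ > τ₀}, slab {x⁰ =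
t} into the leaf F({t} × X), images in J⁺(ιX)) with proper truncations ρᵢ and radii Rᵢ(t) → ∞ along
which the C² truncated deviation → 0, pairwise disjoint truncated tubes eventually, a leaf-adapted
flat chart Φ₀ on U₀ ⊇ {τ₀ < t, ςᵢ(t) < |y − ξᵢ(t)| ∀ i} (ςᵢ sublinear, ξᵢ(t) = t vᵢ + o(t), |vᵢ| <
1) with C² deviation from η → 0, and EXHAUSTION ((J⁺(ιX) ∩ I⁻(Φ₀(late))) ∖ certifiedLate(t₁) ⊆
J⁻(certifiedSlab(t₁)) for all t₁ > τ₀), then ∃ O d with sub-extremal parameters, O = exteriorOf 𝒟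
d.charted and HasExhaustiveCharts d (hole charts Φᵢ ∘ χᵢ⁻¹ ∘ boost⁻¹ restricted and
horizon-normalised to boosted Kerr–Schild exteriors; motions (boost vᵢ, 0); excision radii from ςᵢ +
o(t) + |aᵢ|; C² control transfers along the fixed χᵢ⁻¹ on compacta). [difficulty: XL] -/
@[route_item "route-FinalStateConjecture-LapseTrumpetKID"]
def SliceDictionary : Prop :=
  open Literature.Geometry.Lorentzian in ∀ (X : Type) [TopologicalSpace X] [ChartedSpace E3 X] [IsManifold (𝓡 3) (⊤ : ℕ∞) X] [T2Space X] [SecondCountableTopology X] [ConnectedSpace X] (D : InitialDataSet (𝓡 3) X), D ∈ admissibleVacuumData X → ∀ 𝒟 : VacuumCauchyDevelopment D, 𝒟.IsMaximal → ∀ (F : ℝ × X → 𝒟.carrier), (∃ (n : ℕ) (U : Fin n → Opens E4) (γ : ∀ i, LorentzianMetric 𝓘(ℝ, E4) (⊤ : ℕ∞) (U i)) (b : Fin n → E4 → E4 →L[ℝ] E4 →L[ℝ] ℝ) (ρ : Fin n → E4 → ℝ) (Φ : ∀ i, U i → 𝒟.carrier) (R : Fin n → ℝ → ℝ) (U₀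 : Opens E4) (Φ₀ : U₀ → 𝒟.carrier) (τ₀ : ℝ) (ξ : Fin n → ℝ → E3) (v : Fin n → E3) (ς : Fin n → ℝ → ℝ), (∀ i, ∃ (Mk ak : ℝ), Kerr.IsSubextremal Mk ak ∧ ∃ c : ℝ, 0 < c ∧ ∃ χ : (U i) → E4, ContMDiff 𝓘(ℝ, E4) 𝓘(ℝ, E4) (⊤ : ℕ∞) χ ∧ Injective χ ∧ (∀ x, χ x ∈ (Kerr.region ak 0 : Set E4)) ∧ (∃ r₁ : ℝ, r₁ < Kerr.rPlus Mk ak ∧ (Kerr.region ak r₁ : Set E4) ⊆ range χ) ∧ (∀ (x : (U i)) (v w : E4), (γ i).val x v w = Kerr.bilin Mk ak (χ x) (mfderiv 𝓘(ℝ, E4) 𝓘(ℝ, E4) χ x v) (mfderiv 𝓘(ℝ, E4) 𝓘(ℝ, E4) χ x w)) ∧ (∀ (x y : (U i)) (s : ℝ), (y : E4) = (x : E4) + s • E4.basisVector 0 → χ y = χ x + (c * s) • E4.basisVector 0)) ∧ (∀ i (x : U i), b i x = (γ i).val x) ∧ (∀ i, 𝒟.toSpacetime.IsLateChart (ModelBackground.mk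 (U i) (b i) (fun x ↦ x 0) (ρ i)) univ τ₀ (Φ i)) ∧ (∀ i (x : U i), τ₀ < (x : E4) 0 → Φ i x ∈ 𝒟.metric.causalFuture 𝒟.timeOrientation (range 𝒟.embed) ∧ Φ i x ∈ range (fun y : X ↦ F ((x : E4) 0, y))) ∧ (∀ i (r t : ℝ), IsCompact {x : U i | (x : E4) 0 = t ∧ ρ i x ≤ r}) ∧ (∀ i, Tendsto (R i) atTop atTop ∧ Tendsto (fun t ↦ 𝒟.toSpacetime.truncDeviationCk (ModelBackground.mk (U i) (b i) (fun x ↦ x 0) (ρ i)) (Φ i) 2 (R i t) t) atTop (𝓝 0)) ∧ (∀ r : ℝ, ∃ t₁ : ℝ, Pairwise (onFun Disjoint fun i ↦ Φ i '' (ModelBackground.mk (U i) (b i) (fun x ↦ x 0) (ρ i)).truncLateRegion t₁ r)) ∧ 𝒟.toSpacetime.IsLateChart (Minkowski.backgroundOn U₀) univ τ₀ Φ₀ ∧ (∀ x : U₀, τ₀ < (x : E4) 0 → Φ₀ x ∈ 𝒟.metric.causalFuture 𝒟.timeOrientation (range 𝒟.embed) ∧ Φ₀ x ∈ range (fun y :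 X ↦ F ((x : E4) 0, y))) ∧ Tendsto (fun t ↦ 𝒟.toSpacetime.deviationCk (Minkowski.backgroundOn U₀) Φ₀ 2 t) atTop (𝓝 0) ∧ (∀ i, ‖v i‖ < 1 ∧ Tendsto (fun t ↦ ς i t / t) atTop (𝓝 0) ∧ Tendsto (fun t ↦ ‖ξ i t - t • v i‖ / t) atTop (𝓝 0)) ∧ (∀ (t : ℝ) (y : E3), τ₀ < t → (∀ i, ς i t < ‖y - ξ i t‖) → E4.ofTimeSpace t y ∈ (U₀ : Set E4)) ∧ (∀ t₁ : ℝ, τ₀ < t₁ → (𝒟.metric.causalFuture 𝒟.timeOrientation (range 𝒟.embed) ∩ 𝒟.metric.chronologicalPast 𝒟.timeOrientation (Φ₀ '' (Minkowski.backgroundOn U₀).lateRegion τ₀)) \ (Φ₀ '' (Minkowski.backgroundOn U₀).lateRegion t₁ ∪ ⋃ i, Φ i '' {x : U i | t₁ < (x : E4) 0 ∧ ρ i x ≤ R i ((x : E4) 0)}) ⊆ 𝒟.metric.causalPast 𝒟.timeOrientation (Φ₀ '' (Minkowski.backgroundOn U₀).timeSlab t₁ ∪ ⋃ i, Φ i ''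 (ModelBackground.mk (U i) (b i) (fun x ↦ x 0) (ρ i)).truncTimeSlab (R i t₁) t₁))) → ∃ (O : Set 𝒟.carrier) (d : FinalStateDecomposition 𝒟.toSpacetime O 2), (∀ i, Kerr.IsSubextremal (d.mass i) (d.spin i)) ∧ O = Summit.FinalStateConjecture.exteriorOf 𝒟.toCauchyDevelopment d.charted ∧ Summit.FinalStateConjecture.HasExhaustiveCharts d

/-- item stmt-FinalStateConjecture-10163 · support · rank 9 · open · by planner
sources: doi:10.1103/PhysRevD.7.2814, arXiv:gr-qc/0701037, doi:10.1103/PhysRevLett.113.261101, doi:10.1103/PhysRevD.57.4728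
[support] KERR TRUMPETS EXIST (card P1; anti-vacuity of the trumpet-model clauses and the cheapest
falsifier): for every sub-extremal (M,a) there is an x⁰-stationary vacuum trumpet model (U, γ)
satisfying every hypothesis of TrumpetKIDRigidity and Kerr-embedded with THESE parameters — i.e.
Kerr(M,a) admits a stationary slicing by complete maximal slices, regular across r₊, asymptotic to a
T-invariant maximal cylinder in {r₋ < r < r₊}, lapse → 1 at the AF end and → 0 down the trumpet.
Schwarzschild explicit (C = 3√3M²/4, r_c = 3M/2); Kerr numerically (Dennison–Baumgarte–Montero); a
quasilinear elliptic problem for the height function, kit-computable first. [difficulty: L] -/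
@[route_item "route-FinalStateConjecture-LapseTrumpetKID"]
def KerrTrumpetModel : Prop :=
  open Literature.Geometry.Lorentzian in ∀ (Mk ak : ℝ), Kerr.IsSubextremal Mk ak → ∃ (U : Opens E4) (γ : LorentzianMetric 𝓘(ℝ, E4) (⊤ : ℕ∞) U), ((∀ x ∈ (U : Set E4), ∀ s : ℝ, x + s • E4.basisVector 0 ∈ (U : Set E4)) ∧ (∀ (x y : U) (s : ℝ), (y : E4) = (x : E4) + s • E4.basisVector 0 → ∀ v w : E4, γ.val y v w = γ.val x v w) ∧ (∀ [γ.toPseudoRiemannianMetric.HasLeviCivita], γ.toPseudoRiemannianMetric.IsRicciFlat) ∧ (∃ C : ℝ, ∀ x : U, γ.val x (E4.basisVector 0) (E4.basisVector 0) ≤ C) ∧ ∃ (V : Opens E3) (σ : V → U) (νV : NormalField 𝓘(ℝ, E4) σ) (DV : InitialDataSet (𝓡 3) V) (e : AFEnd V), (V : Set E3) = {y | E4.ofTimeSpace 0 y ∈ (U : Set E4)} ∧ (∀ y, (σ y : E4) = E4.ofTimeSpace 0 y) ∧ γ.toPseudoRiemannianMetric.IsUnitNormal (𝓡 3) σ νV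 (-1) ∧ (∀ (y : V) (v w : TangentSpace (𝓡 3) y), DV.h.inner y v w = γ.val (σ y) (mfderiv (𝓡 3) 𝓘(ℝ, E4) σ y v) (mfderiv (𝓡 3) 𝓘(ℝ, E4) σ y w)) ∧ (∀ [γ.toPseudoRiemannianMetric.HasLeviCivita] (y : V), γ.toPseudoRiemannianMetric.secondFundamentalForm (𝓡 3) σ νV y = DV.kBilin y) ∧ DV.IsMaximalData ∧ (∀ [DV.metric.HasLeviCivita], DV.IsComplete) ∧ Nonempty (Diffeomorph (𝓡 3) (𝓡 3) V ((⟨({0} : Set E3)ᶜ, isOpen_compl_singleton⟩ : Opens E3)) (⊤ : ℕ∞)) ∧ e.IsAsymptoticallyFlat DV 1 ∧ (∀ y : V, 0 < - γ.val (σ y) (E4.basisVector 0) (νV y)) ∧ Tendsto (fun z : exteriorRegion e.R ↦ - γ.val (σ (e.dataChart z)) (E4.basisVector 0) (νV (e.dataChart z))) (comap (fun z : exteriorRegion e.R ↦ ‖(z : E3)‖) atTop) (𝓝 1) ∧ (∀ ε : ℝ, 0 < ε → ∃ K : Set V, IsCompact K ∧ ∀ y : V, y ∉ K → y ∉ (e.U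 : Set V) → - γ.val (σ y) (E4.basisVector 0) (νV y) < ε) ∧ (∃ ε : ℝ, 0 < ε ∧ ∃ R' : ℝ, ∀ τU : TimeOrientation γ, (∀ y : V, τU.IsFutureDirected (νV y)) → ∀ y : V, - γ.val (σ y) (E4.basisVector 0) (νV y) < ε → ∀ p : U, (∃ (z : V) (s : ℝ), z ∈ e.far R' ∧ (p : E4) = (σ z : E4) + s • E4.basisVector 0) → p ∉ γ.causalFuture τU {σ y})) ∧ ∃ c : ℝ, 0 < c ∧ ∃ χ : U → E4, ContMDiff 𝓘(ℝ, E4) 𝓘(ℝ, E4) (⊤ : ℕ∞) χ ∧ Injective χ ∧ (∀ x, χ x ∈ (Kerr.region ak 0 : Set E4)) ∧ (∃ r₁ : ℝ, r₁ < Kerr.rPlus Mk ak ∧ (Kerr.region ak r₁ : Set E4) ⊆ range χ) ∧ (∀ (x : U) (v w : E4), γ.val x v w = Kerr.bilin Mk ak (χ x) (mfderiv 𝓘(ℝ, E4) 𝓘(ℝ, E4) χ x v) (mfderiv 𝓘(ℝ, E4) 𝓘(ℝ, E4) χ x w)) ∧ (∀ (x y : U) (s : ℝ), (y : E4) = (x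 : E4) + s • E4.basisVector 0 → χ y = χ x + (c * s) • E4.basisVector 0)

/-- item stmt-FinalStateConjecture-10164 · support · rank 9 · open · by planner
sources: Christodoulou1999, arXiv:0811.0354, arXiv:1710.01722
[support] THE SHARED CONJUNCT (weak cosmic censorship in the typed form, for cross-route
deduplication; implied by MaximalCensorship via monotonicity of genericity; not used by `closes`):
for Christodoulou-generic admissible data an MGHD exists and every MGHD has complete future null
infinity. [difficulty: open-problem] -/
@[route_item "route-FinalStateConjecture-LapseTrumpetKID"]
def WeakCosmicCensorship : Prop :=
  open Literature.Geometry.Lorentzian in ∀ (X : Type) [TopologicalSpace X] [ChartedSpace E3 X] [IsManifold (𝓡 3) (⊤ : ℕ∞) X] [T2Space X] [SecondCountableTopology X] [ConnectedSpace X], InitialDataSet.IsChristodoulouGeneric (admissibleVacuumData X) (fun D ↦ (∃ 𝒟 : VacuumCauchyDevelopment D, 𝒟.IsMaximal) ∧ ∀ 𝒟 : VacuumCauchyDevelopment D, 𝒟.IsMaximal → Summit.FinalStateConjecture.HasCompleteNullInfinity 𝒟.toCauchyDevelopment) 1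

-- earlier Assembly (stmt-FinalStateConjecture-10165, replaced 2026-08-17T00:27:20Z -> stmt-FinalStateConjecture-16818): retired by None — MaximalCensorship → SettlingInMaximalGauge → TrappedWellsSubextremal → _root_.FinalStateConjecture
/-- item stmt-FinalStateConjecture-16818 · assembly · rank 1 · open · by planner
sources: arXiv:1710.01722, Christodoulou1999
[assembly] MaximalCensorship → SettlingInMaximalGauge → TrappedWellsSubextremal → TrumpetKIDRigidity
→ FinalStateConjecture — verbatim the type of the deciding theorem `closes` (proved, sorry-free,
axioms propext/Classical.choice/Quot.sound); the previous frame item listed only the first three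
hypotheses. Sources: arXiv:1710.01722, Christodoulou1999. -/
@[route_item "route-FinalStateConjecture-LapseTrumpetKID"]
def Assembly : Prop :=
  MaximalCensorship → SettlingInMaximalGauge → TrappedWellsSubextremal → TrumpetKIDRigidity → _root_.FinalStateConjecture

/-! D-0027 §2.1 — DECIDING THEOREM (planner-authored via `route open/edit --closes-file`; by planner-rbadge-FinalStateConjecture-LapseTrump-731f1007-g3-0 2026-08-17T00:27:20Z):
its hypotheses are this route's items and its conclusion the sub-problem Statement (glue_lint), and it elaborates with this file. -/

/-- The deciding theorem of route `LapseTrumpetKID` (D-0027 §2.1), re-certified 2026-08-17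
(route-repair g3, glue stamp). Hypotheses = the route's four crux items in rank order
(`MaximalCensorship` r2, `SettlingInMaximalGauge` r3, `TrappedWellsSubextremal` r4,
`TrumpetKIDRigidity` r5); conclusion = the sub-problem Statement decl `_root_.FinalStateConjecture`
by name. Pure logic, no named fact:
(1) tame Christodoulou genericity `IsTameChristodoulouGeneric 𝓓 P 1` is MONOTONE in the property
`P` — a pointwise implication `Q → P` on the admissible class shrinks the exceptional set, and the
tame, immersed, injective one-parameter admissible family on its fixed end witnessing codimension
for `Q` witnesses it for `P` (step `mono`);
(2) pointwise on an admissible datum `D`: `MaximalCensorship` gives MGHD existence and, for every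
MGHD `𝒟`, complete `𝓘⁺` plus a normalised maximal Cauchy foliation `(F, ν)` with trapped wells;
`SettlingInMaximalGauge` turns `(𝒟, F, ν)` into `O`, `d` with `O = exteriorOf 𝒟 d.charted`,
`RaysStayInClosure`, `HasExhaustiveCharts`, `IsFutureOriented`; `TrappedWellsSubextremal` (fed the
same foliation, `O = exteriorOf` and `HasExhaustiveCharts`) gives `|aᵢ| < Mᵢ`.
`TrumpetKIDRigidity` rides as the fourth hypothesis (the identification step inside the intended
layer-2 split of `SettlingInMaximalGauge`; not consumed by the term until that split is filed).
The fullbuild stamp `478:2 Type mismatch` (build-broken 2026-08-16T23:33:01Z) was raised against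
the pre-repair rev-3 render (old `IsChristodoulouGeneric` glue vs the re-typed Statement, T2);
the rev-4 text (2026-08-16T23:47Z) and this one elaborate natively (rev 5 of 00:24Z recorded this text
provisional/textual only — right after a gate restart —, hence the re-submission for the native pass). -/
@[closes "route-FinalStateConjecture-LapseTrumpetKID"] theorem closes (hMC : MaximalCensorship) (hS : SettlingInMaximalGauge)
    (hT : TrappedWellsSubextremal) (_hR : TrumpetKIDRigidity) :
    _root_.FinalStateConjecture := by
  intro X _ _ _ _ _ _
  -- (1) monotonicity of tame Christodoulou genericity in the property
  have mono : ∀ {Q P : Literature.Geometry.Lorentzian.InitialDataSet (𝓡 3) X → Prop},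
      (∀ D ∈ Literature.Geometry.Lorentzian.admissibleVacuumData X, Q D → P D) →
      Literature.Geometry.Lorentzian.InitialDataSet.IsTameChristodoulouGeneric
        (Literature.Geometry.Lorentzian.admissibleVacuumData X) Q 1 →
      Literature.Geometry.Lorentzian.InitialDataSet.IsTameChristodoulouGeneric
        (Literature.Geometry.Lorentzian.admissibleVacuumData X) P 1 := by
    intro Q P hQP hQ d hd
    obtain ⟨e, Fam, hF, hImm, h0, hinj, hD, hE⟩ := hQ d ⟨hd.1, fun hq ↦ hd.2 (hQP d hd.1 hq)⟩
    exact ⟨e, Fam, hF, hImm, h0, hinj, hD,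
      fun c hc hmem ↦ hE c hc ⟨hmem.1, fun hq ↦ hmem.2 (hQP _ hmem.1 hq)⟩⟩
  refine mono ?_ (hMC X)
  -- (2) the pointwise upgrade on an admissible datum
  intro D hD hq
  refine ⟨hq.1, fun 𝒟 h𝒟 ↦ ?_⟩
  obtain ⟨hCNI, F, ν, hMF, hWT⟩ := hq.2 𝒟 h𝒟
  obtain ⟨O, dd, hO, hRays, hEx, hFO⟩ := hS X D hD 𝒟 h𝒟 hCNI F ν hMF hWT
  exact ⟨hCNI, O, dd, hT X D hD 𝒟 h𝒟 hCNI F ν hMF hWT O dd hO hEx, hO, hRays, hEx, hFO⟩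

end Summit.FinalStateConjecture.FinalStateConjecture.Theses.LapseTrumpetKID
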